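import Mathlib
import Summits.Ventures.PercRepro2.Defs
import Summits.Ventures.PercRepro2.Independence
import Summits.Ventures.PercRepro2.Harris
import Summits.Ventures.PercRepro2.Graph
import Summits.Ventures.PercRepro2.Exploration
import Summits.Ventures.PercRepro2.ObsIndependence
import Summits.Ventures.PercRepro2.BasePrime

/-!
# (BASE) at a pendant root (blind cell PercRepro2, p1; `proofs/P1-TWOCOPY.md` §9)

The 2-colouring base (BASE) of `TwoCopyBHK.lean`,

  `P(l ↮_R h, l ↮_B h, o ↔_R l, b ↔_R h) ≤ P(l ↮_R h, l ↮_B h, o ↔_R l, b ↔_B h)`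

(uniform 2-colourings; red = `ω`, blue = `flipAll ω`), holds whenever the root `l` is a LEAF: with
`f = {l, u}` its only edge, summing over the colour of `f` reduces the statement to (BASE′) on the
graph with `l` replaced by `u` (`basePrime`): when `f` is red, `l`'s red cluster is `u`'s and `l` is
blue-isolated (so the blue avoidance is automatic); when `f` is blue, `l` is red-isolated and
`o ↔_R l` fails, so both sides vanish.
-/

namespace Summit.Ventures.PercRepro2

section Leaf

variable {V : Type*} {E : Type*} [DecidableEq E]

omit [DecidableEq E] in
/-- Open adjacency from a leaf `l` (all of whose edges are `f = {l, u}`) goes to `u` through `f`. -/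
lemma openAdj_leaf {ends : E → Sym2 V} {ω : Config E} {l u : V} {f : E}
    (hf : ends f = s(l, u)) (hleaf : ∀ e, l ∈ ends e → e = f) (hlu : l ≠ u) {y : V}
    (h : OpenAdj ends ω l y) : ω f = true ∧ y = u := by
  obtain ⟨e, he, hends⟩ := h
  have hef : e = f := hleaf e (by rw [hends]; exact Sym2.mem_mk_left l y)
  subst hef
  refine ⟨he, ?_⟩
  rw [hf, Sym2.eq_iff] at hends
  rcases hends with ⟨_, h2⟩ | ⟨_, h2⟩
  · exact h2.symm
  · exact absurd h2.symm hlu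

omit [DecidableEq E] in
/-- With the leaf edge closed, the leaf is isolated. -/
lemma conn_leaf_closed {ends : E → Sym2 V} {ω : Config E} {l u : V} {f : E}
    (hf : ends f = s(l, u)) (hleaf : ∀ e, l ∈ ends e → e = f) (hlu : l ≠ u) (hωf : ω f = false)
    {v : V} (h : Conn ends ω l v) : v = l := by
  have hS : ∀ x ∈ ({l} : Set V), ∀ y, (openGraph ends ω).Adj x y → y ∈ ({l} : Set V) := by
    intro x hx y hxy
    rw [Set.mem_singleton_iff] at hx
    subst hx
    obtain ⟨_, hadj⟩ := openGraph_adj.1 hxy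
    have := (openAdj_leaf hf hleaf hlu hadj).1
    rw [hωf] at this
    exact absurd this Bool.false_ne_true
  exact mem_of_conn_of_closed hS rfl h

omit [DecidableEq E] in
/-- With the leaf edge open, the leaf is connected to exactly what `u` is connected to. -/
lemma conn_leaf_open {ends : E → Sym2 V} {ω : Config E} {l u : V} {f : E}
    (hf : ends f = s(l, u)) (hωf : ω f = true) {v : V} :
    Conn ends ω l v ↔ Conn ends ω u v := by
  have hlu : Conn ends ω l u := conn_of_openAdj ⟨f, hωf, hf⟩
  constructor
  · intro h; exact conn_trans (conn_symm hlu) h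
  · intro h; exact conn_trans hlu h

omit [DecidableEq E] in
/-- Two configurations that agree off the leaf edge have the same connections among the vertices
other than the leaf. -/
lemma conn_of_conn_of_eq_off_leaf {ends : E → Sym2 V} {ω₁ ω₂ : Config E} {l u : V} {f : E}
    (hf : ends f = s(l, u)) (hleaf : ∀ e, l ∈ ends e → e = f) (hlu : l ≠ u)
    (hagree : ∀ e, e ≠ f → ω₁ e = ω₂ e) {x v : V} (hx : x ≠ l) (hv : v ≠ l)
    (h : Conn ends ω₁ x v) : Conn ends ω₂ x v := by
  let S : Set V := {y | Conn ends ω₂ x y ∨ (y = l ∧ Conn ends ω₂ x u)}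
  have hS : ∀ y ∈ S, ∀ z, (openGraph ends ω₁).Adj y z → z ∈ S := by
    intro y hy z hyz
    obtain ⟨hne, e, he, hends⟩ := openGraph_adj.1 hyz
    by_cases hyl : y = l
    · subst hyl
      have hzu := (openAdj_leaf hf hleaf hlu ⟨e, he, hends⟩).2
      subst hzu
      rcases hy with hyc | ⟨_, hu⟩
      · -- `x ↔ l` in `ω₂`: the leaf edge is open there and `x ↔ u`
        have hf2 : ω₂ f = true := by
          by_contra hc
          have hc' : ω₂ f = false := by cases hω : ω₂ f <;> simp_all
          exact hx (conn_leaf_closed hf hleaf hlu hc' (conn_symm hyc))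
        exact Or.inl (conn_symm ((conn_leaf_open hf hf2).1 (conn_symm hyc)))
      · exact Or.inl hu
    · have hyc : Conn ends ω₂ x y := by
        rcases hy with hyc | ⟨hyl', _⟩
        · exact hyc
        · exact absurd hyl' hyl
      by_cases hef : e = f
      · subst hef
        rw [hf, Sym2.eq_iff] at hends
        rcases hends with ⟨h1, _⟩ | ⟨h1, h2⟩
        · exact absurd h1.symm hyl
        · exact Or.inr ⟨h1.symm, h2 ▸ hyc⟩
      · have he' : ω₂ e = true := by rw [← hagree e hef]; exact he
        exact Or.inl (conn_trans hyc (conn_of_openAdj ⟨e, he', hends⟩))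
  have hmem : v ∈ S := mem_of_conn_of_closed hS (Or.inl (conn_refl ends ω₂ x)) h
  rcases hmem with hvc | ⟨hvl, _⟩
  · exact hvc
  · exact absurd hvl hv

/-- Pinning the leaf edge does not change the connections among the other vertices. -/
lemma conn_update_leaf_iff {ends : E → Sym2 V} {ω : Config E} {l u : V} {f : E}
    (hf : ends f = s(l, u)) (hleaf : ∀ e, l ∈ ends e → e = f) (hlu : l ≠ u) (c : Bool) {x v : V}
    (hx : x ≠ l) (hv : v ≠ l) : Conn ends (Function.update ω f c) x v ↔ Conn ends ω x v := by
  have hagree : ∀ e, e ≠ f → Function.update ω f c e = ω e :=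
    fun e he => Function.update_of_ne he c ω
  constructor
  · exact conn_of_conn_of_eq_off_leaf hf hleaf hlu hagree hx hv
  · exact conn_of_conn_of_eq_off_leaf hf hleaf hlu (fun e he => (hagree e he).symm) hx hv

end Leaf

section Pendant

variable {V : Type*} {E : Type*} [Fintype E] [DecidableEq E] [Fintype V] [DecidableEq V]
  {R : Type*} [Field R] [LinearOrder R] [IsStrictOrderedRing R]

omit [Fintype V] [DecidableEq V] [LinearOrder R] [IsStrictOrderedRing R] in
/-- The probability of a preimage as an expectation of the composed indicator. -/
lemma prob_preimage_eq_expect (p : E → R) (g : Config E → Config E) (A : Set (Config E)) :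
    prob p (g ⁻¹' A) = expect p (fun ω => A.indicator 1 (g ω)) := by
  unfold prob expect
  refine Finset.sum_congr rfl fun ω _ => ?_
  by_cases h : g ω ∈ A
  · simp [h]
  · simp [h]

omit [Fintype E] [Fintype V] [DecidableEq V] [Field R] [LinearOrder R] [IsStrictOrderedRing R] in
/-- Flipping after pinning an edge open is pinning it closed after flipping. -/
lemma flipAll_update_true (ω : Config E) (f : E) :
    flipAll (Function.update ω f true) = Function.update (flipAll ω) f false := by
  funext e
  by_cases hef : e = f
  · subst hef; simp [flipAll]
  · simp [flipAll, Function.update_of_ne hef]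

/-- **(BASE) at a pendant root**: if `l` is a leaf (its only edge is `f = {l, u}`), then under
uniform 2-colourings
`P(l ↮_R h, l ↮_B h, o ↔_R l, b ↔_R h) ≤ P(l ↮_R h, l ↮_B h, o ↔_R l, b ↔_B h)`. -/
theorem basePendant (ends : E → Sym2 V) {l u : V} {f : E} (hf : ends f = s(l, u))
    (hleaf : ∀ e, l ∈ ends e → e = f) (hlu : l ≠ u) {h o b : V} (hh : h ≠ l) (ho : o ≠ l)
    (hb : b ≠ l) :
    prob (half (E := E) (R := R)) ((connEvent ends l h)ᶜ ∩ flipAll ⁻¹' (connEvent ends l h)ᶜ ∩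
        connEvent ends l o ∩ connEvent ends h b) ≤
      prob (half (E := E) (R := R)) ((connEvent ends l h)ᶜ ∩ flipAll ⁻¹' (connEvent ends l h)ᶜ ∩
        connEvent ends l o ∩ flipAll ⁻¹' connEvent ends h b) := by
  -- the events with the pendant edge pinned open are the (BASE′) events at `u`
  have hR1 : (fun ω : Config E => Function.update ω f true) ⁻¹'
      ((connEvent ends l h)ᶜ ∩ flipAll ⁻¹' (connEvent ends l h)ᶜ ∩ connEvent ends l o ∩
        connEvent ends h b) =
      (connEvent ends u h)ᶜ ∩ connEvent ends u o ∩ connEvent ends h b := by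
    ext ω
    simp only [Set.mem_preimage, Set.mem_inter_iff, Set.mem_compl_iff, mem_connEvent]
    have hopen : Function.update ω f true f = true := by simp
    have hlh : Conn ends (Function.update ω f true) l h ↔ Conn ends ω u h := by
      rw [conn_leaf_open hf hopen]
      exact conn_update_leaf_iff hf hleaf hlu true (Ne.symm hlu) hh
    have hlo : Conn ends (Function.update ω f true) l o ↔ Conn ends ω u o := by
      rw [conn_leaf_open hf hopen]
      exact conn_update_leaf_iff hf hleaf hlu true (Ne.symm hlu) ho
    have hhb : Conn ends (Function.update ω f true) h b ↔ Conn ends ω h b :=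
      conn_update_leaf_iff hf hleaf hlu true hh hb
    have hblue : ¬ Conn ends (flipAll (Function.update ω f true)) l h := by
      rw [flipAll_update_true]
      intro hc
      exact hh (conn_leaf_closed hf hleaf hlu (by simp) hc)
    rw [hlh, hlo, hhb]
    tauto
  have hB1 : (fun ω : Config E => Function.update ω f true) ⁻¹'
      ((connEvent ends l h)ᶜ ∩ flipAll ⁻¹' (connEvent ends l h)ᶜ ∩ connEvent ends l o ∩
        flipAll ⁻¹' connEvent ends h b) =
      (connEvent ends u h)ᶜ ∩ connEvent ends u o ∩ flipAll ⁻¹' connEvent ends h b := by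
    ext ω
    simp only [Set.mem_preimage, Set.mem_inter_iff, Set.mem_compl_iff, mem_connEvent]
    have hopen : Function.update ω f true f = true := by simp
    have hlh : Conn ends (Function.update ω f true) l h ↔ Conn ends ω u h := by
      rw [conn_leaf_open hf hopen]
      exact conn_update_leaf_iff hf hleaf hlu true (Ne.symm hlu) hh
    have hlo : Conn ends (Function.update ω f true) l o ↔ Conn ends ω u o := by
      rw [conn_leaf_open hf hopen]
      exact conn_update_leaf_iff hf hleaf hlu true (Ne.symm hlu) ho
    have hhb : Conn ends (flipAll (Function.update ω f true)) h b ↔ Conn ends (flipAll ω) h b := by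
      rw [flipAll_update_true]
      exact conn_update_leaf_iff hf hleaf hlu false hh hb
    have hblue : ¬ Conn ends (flipAll (Function.update ω f true)) l h := by
      rw [flipAll_update_true]
      intro hc
      exact hh (conn_leaf_closed hf hleaf hlu (by simp) hc)
    rw [hlh, hlo, hhb]
    tauto
  -- with the pendant edge pinned closed, `o ↔_R l` fails
  have h0 : ∀ A : Set (Config E), A ⊆ connEvent ends l o →
      (fun ω : Config E => Function.update ω f false) ⁻¹' A = ∅ := by
    intro A hA
    ext ω
    simp only [Set.mem_preimage, Set.mem_empty_iff_false, iff_false]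
    intro hm
    have hc := hA hm
    rw [mem_connEvent] at hc
    exact ho (conn_leaf_closed hf hleaf hlu (by simp) hc)
  -- pin the pendant edge
  have key : ∀ A : Set (Config E), A ⊆ connEvent ends l o →
      prob (half (E := E) (R := R)) A =
        (1 / 2 : R) * prob half ((fun ω : Config E => Function.update ω f true) ⁻¹' A) := by
    intro A hA
    rw [prob_eq_pin half A f]
    have e1 : prob (Function.update (half (E := E) (R := R)) f 1) A =
        prob half ((fun ω : Config E => Function.update ω f true) ⁻¹' A) := by
      rw [prob_eq_expect_indicator, expect_update_one, prob_preimage_eq_expect]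
    have e0 : prob (Function.update (half (E := E) (R := R)) f 0) A = 0 := by
      rw [prob_eq_expect_indicator, expect_update_zero, ← prob_preimage_eq_expect, h0 A hA]
      simp
    rw [e1, e0]
    simp [half]
  have kR := key ((connEvent ends l h)ᶜ ∩ flipAll ⁻¹' (connEvent ends l h)ᶜ ∩
    connEvent ends l o ∩ connEvent ends h b) (fun ω hω => hω.1.2)
  have kB := key ((connEvent ends l h)ᶜ ∩ flipAll ⁻¹' (connEvent ends l h)ᶜ ∩
    connEvent ends l o ∩ flipAll ⁻¹' connEvent ends h b) (fun ω hω => hω.1.2)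
  rw [kR, kB, hR1, hB1]
  exact mul_le_mul_of_nonneg_left (basePrime ends u h o b) (by norm_num)

end Pendant

end Summit.Ventures.PercRepro2
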